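import Literature.Topology.Immersions.ProjectionFieldBundle
import Literature.Topology.FourManifolds.NormalRetraction
import HarnessLib

/-!
# The normal bundle of an immersion into Euclidean space as a projection-field bundle

Topic `Literature/Topology/Immersions`. For a `C^∞` immersion `f : M → ℝ^q` of an `n`-manifold
the **normal bundle** `ν_f`, `(ν_f)_x = (df(T_x M))ᗮ ⊆ ℝ^q`, is a rank-`(q - n)` sub-bundle of
the trivial bundle `M × ℝ^q`; in the tree's vocabulary (`ProjectionFieldBundle.lean`) it is the
smooth field of orthogonal projections `x ↦ 1 - P_x` complementary to the tangent projections
`P_x = Literature.Topology.FourManifolds.tangentProj` of `NormalRetraction.lean` (smooth by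
`contMDiff_tangentProj`; Milnor–Stasheff, *Characteristic Classes* (1974), §3, Thm. 3.3 / p. 29:
the normal bundle of an immersion as the orthogonal complement of the tangent bundle in the
trivial bundle). This is the object on which the normal Euler class / normal framings of
immersions `M⁴ ↬ ℝ⁶` are read (Kirby, *The Topology of 4-Manifolds* (1989), Ch. VI).

* `ProjBundle.normalProj n f x` (`= 1 - tangentProj`), `ProjBundle.normal hk f hf himm : ProjBundle n q k M`
  (`k + n = q`);
* `ProjBundle.fibre_normal_eq`, `ProjBundle.mem_fibre_normal_iff` (`v ∈ ν_x ↔ v ⊥ df(T_x M)`),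
  `ProjBundle.normalProj_mfderiv` (`(1 - P_x)(df_x ξ) = 0`).

Everything here is proved; no named facts are introduced.

## References

* J. Milnor, J. Stasheff, *Characteristic Classes* (1974), §3 (Thm. 3.3, normal bundle of an
  immersion p. 29). [MilnorStasheff1974]
* R. C. Kirby, *The Topology of 4-Manifolds*, LNM 1374 (1989), Ch. VI. [Kirby1989]
-/

open scoped Manifold ContDiff Topology RealInnerProductSpace
open Set Function Module

noncomputable section

namespace Literature.Topology.Immersions

/-- Local notation: `𝔼 n` is the model Euclidean space `EuclideanSpace ℝ (Fin n)`. -/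
local notation "𝔼 " n:arg => EuclideanSpace ℝ (Fin n)

open Literature.Topology.FourManifolds (tangentPlane tangentProj normalSpace contMDiff_tangentProj
  finrank_normalSpace_add mfderiv_mem_tangentPlane)

namespace ProjBundle

variable {n q k : ℕ} {M : Type*} [TopologicalSpace M] [ChartedSpace (𝔼 n) M]

/-- The **normal projection** of `f` at `x`: the orthogonal projection of `ℝ^q` onto
`(df(T_x M))ᗮ`. [folklore] -/
def normalProj (n : ℕ) {M : Type*} [TopologicalSpace M] [ChartedSpace (𝔼 n) M] (f : M → 𝔼 q) (x : M) :
    𝔼 q →L[ℝ] 𝔼 q :=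
  (normalSpace (𝓡 n) f x).starProjection

/-- `normalProj = 1 - tangentProj`. [folklore] -/
theorem normalProj_apply (f : M → 𝔼 q) (x : M) (v : 𝔼 q) :
    normalProj n f x v = v - tangentProj (𝓡 n) f x v :=
  Submodule.starProjection_orthogonal_val (K := tangentPlane (𝓡 n) f x) v

/-- `normalProj = 1 - tangentProj` as maps. [folklore] -/
theorem normalProj_eq (f : M → 𝔼 q) :
    normalProj n f = fun x => (1 : 𝔼 q →L[ℝ] 𝔼 q) - tangentProj (𝓡 n) f x := by
  funext x
  ext1 v
  exact normalProj_apply f x v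

/-- **The normal bundle of an immersion `f : M → ℝ^q`** as a projection-field bundle of rank
`k = q - n`: `x ↦` the orthogonal projection onto `(df(T_x M))ᗮ`.
[cite: MilnorStasheff1974, §3 Thm. 3.3] -/
def normal [IsManifold (𝓡 n) ∞ M] (hk : k + n = q) (f : M → 𝔼 q)
    (hf : ContMDiff (𝓡 n) (𝓡 q) ∞ f)
    (himm : ∀ x, Injective (mfderiv (𝓡 n) (𝓡 q) f x)) : ProjBundle n q k M where
  proj := normalProj n f
  contMDiff_proj' := by
    rw [normalProj_eq]
    exact contMDiff_const.sub (contMDiff_tangentProj (I := 𝓡 n) hf himm)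
  proj_proj x v := by
    show (normalSpace (𝓡 n) f x).starProjection ((normalSpace (𝓡 n) f x).starProjection v) =
      (normalSpace (𝓡 n) f x).starProjection v
    rw [Submodule.starProjection_eq_self_iff]
    exact Submodule.starProjection_apply_mem _ v
  inner_proj_comm x v w := Submodule.inner_starProjection_left_eq_right _ v w
  finrank_range x := by
    have h1 : LinearMap.range (normalProj n f x).toLinearMap = normalSpace (𝓡 n) f x :=
      Submodule.range_starProjection _
    rw [h1]
    have h2 := finrank_normalSpace_add (I := 𝓡 n) (e := f) (himm x)
    rw [finrank_euclideanSpace_fin, finrank_euclideanSpace_fin] at h2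
    omega

/-- The projection field of the normal bundle is `normalProj`. [folklore] -/
theorem normal_proj [IsManifold (𝓡 n) ∞ M] (hk : k + n = q) {f : M → 𝔼 q}
    (hf : ContMDiff (𝓡 n) (𝓡 q) ∞ f) (himm : ∀ x, Injective (mfderiv (𝓡 n) (𝓡 q) f x)) :
    (normal hk f hf himm).proj = normalProj n f := rfl

/-- **The fibre of the normal bundle is the normal space** `(df(T_x M))ᗮ`. [folklore] -/
theorem fibre_normal_eq [IsManifold (𝓡 n) ∞ M] (hk : k + n = q) {f : M → 𝔼 q}
    (hf : ContMDiff (𝓡 n) (𝓡 q) ∞ f)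
    (himm : ∀ x, Injective (mfderiv (𝓡 n) (𝓡 q) f x)) (x : M) :
    (normal hk f hf himm).fibre x = normalSpace (𝓡 n) f x :=
  Submodule.range_starProjection _

/-- Membership in the fibre of the normal bundle: orthogonality to the tangent plane.
[folklore] -/
theorem mem_fibre_normal_iff [IsManifold (𝓡 n) ∞ M] (hk : k + n = q) {f : M → 𝔼 q}
    (hf : ContMDiff (𝓡 n) (𝓡 q) ∞ f)
    (himm : ∀ x, Injective (mfderiv (𝓡 n) (𝓡 q) f x)) (x : M) (v : 𝔼 q) :
    v ∈ (normal hk f hf himm).fibre x ↔ ∀ u ∈ tangentPlane (𝓡 n) f x, ⟪u, v⟫ = 0 := by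
  rw [fibre_normal_eq, Submodule.mem_orthogonal]

/-- **The normal projection kills tangent vectors**: `(1 - P_x)(df_x ξ) = 0`. [folklore] -/
theorem normalProj_mfderiv (f : M → 𝔼 q) (x : M) (ξ : 𝔼 n) :
    normalProj n f x (mfderiv (𝓡 n) (𝓡 q) f x ξ) = 0 :=
  Submodule.starProjection_orthogonal_apply_eq_zero (mfderiv_mem_tangentPlane (I := 𝓡 n) f x ξ)

end ProjBundle

end Literature.Topology.Immersions
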